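/-
Copyright (c) 2026. All rights reserved.
Released under Apache 2.0 license as described in the file LICENSE.
Authors: abc-iut cell, seat abc-iut-w6-d025 (gen 2; block C / W6, row «Cor36-LOGOBS-TELE»).
-/
import Literature.AnabelianGeometry.AbsoluteAnabelian.AbsTopIII.FrobeniusPictureMLFLogTeleFamilyEta

/-!
# [AbsTopIII] Cor. 3.6 (iii), second clause, telecore half: the glued family on `𝒟_An` and the
# statement `LogObsCompatTelecoreStmt`, modulo the two tail identities at `𝒩`

S. Mochizuki, *Topics in Absolute Anabelian Geometry III*, Cor. 3.6 (iii) p. 80 of the kurims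
manuscript (`paper:url-5493eb38cbb7`; bib key `MochizukiAbsTopIII2015`); proof p. 81 ("the various
Galois groups that appear remain 'undisturbed'").  Continuation of
`FrobeniusPictureMLFLogTeleFamilyEta.lean`.

* The homotopy `teleGlueη h` of a glued pair (by any decomposition — `TDec.η_eq`), its over-ness, and the
  AXIOMS of a family of homotopies (Def. 3.5 (ii)) for it at every target vertex whose structure
  functor over `ℰ` is FAITHFUL — `Anab` (`Anab → ℰ` fully faithful), `ℰ` (`𝟭`), `□` (`𝒳 → ℰ`,
  faithful for EVERY `Δ`: `(𝒳 → ℰ) ⋙ κ_An ⋙ φ_An ≅ 𝟭`), the first row (`id_⋎ ⋙ (𝒳 → ℰ)`, faithful when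
  `id_⋎` is) — where they follow from UNIQUENESS of over-homotopies (`IsOver.eq_of_faithful`):
  `teleGlueη_trans_of_faithful`, `teleGlueη_whisker_of_faithful`.  The structure functor at `𝒩` (`𝒩 → ℰ`)
  is not faithful in general (in the model the morphisms of `𝒞_TS`-pairs carry a map of spaces), so
  the two axioms for pairs into `𝒩` are explicit tail identities, taken here as the hypotheses
  `htrans`, `hwhisk` (discharged in the continuation file).
* `logTeleFamily`: the glued family on `𝒟_An` (boundary set `TGlueE G₁.E`, homotopies `teleGlueη`).
* `jfam_compatibleAlong_logTeleFamily`: it contains the telecore family `𝒥` of `𝔗_An` over `ℰ`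
  (`anTelecoreE τ`): on a pair through `Anab` both homotopies are the whiskered lift of the prefixes.
* `compatibleAlong_embLogTele_logTeleFamily`: it contains (along `𝒟_{≤3} ↪ 𝒟_An`, which factors as
  `jS ∘ logToF`) every family contained in `G₁` along `logToF`.
* `logObsCompatTelecoreStmt_of_family`: **Cor. 3.6 (iii), second clause, telecore half**
  (`LogObsCompatTelecoreStmt τ`, = the second conjunct of `AbsTopIII.Cor_4_5_iii_compat`) from such a
  `G₁` containing the `𝔖_log` family, modulo `htrans`, `hwhisk`.

Pure category theory over the abstract data `LogFrobeniusData`; nothing here takes a side on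
inter-universal Teichmüller theory or bears on [IUTchIII] Cor. 3.12.
-/

namespace Literature.AnabelianGeometry.AbsoluteAnabelian

open _root_.CategoryTheory _root_.Quiver

universe u

namespace LogFrobeniusData

open DiagramOfCategories

variable (Δ : LogFrobeniusData.{u}) (τ : Δ.TelecoreData)
variable (G₁ : ((Δ.teleDiagram anJ (Δ.anTelMap τ)).comapAlong jS.{u}).HomotopyFamily)

/-! ### Faithfulness of the structure functors over `ℰ` -/

/-- **`𝒳 → ℰ` is faithful** for every `Δ`: `(𝒳 → ℰ) ⋙ κ_An ⋙ φ_An ≅ 𝟭_𝒳` (`η_An`).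
[cite: MochizukiAbsTopIII2015, Corollary 3.6 (ii) p.79] -/
theorem xtoE_faithful : Δ.XtoE.Faithful :=
  Functor.Faithful.of_comp_iso (G := Δ.κ ⋙ Δ.φ) (H := 𝟭 Δ.X) Δ.η

/-- The structure functor of `𝒟_An` over `ℰ` at `Anab` is faithful (`Anab → ℰ` is fully faithful).
[cite: MochizukiAbsTopIII2015, Definition 3.1 (vi) p.70] -/
theorem teleOverE_faithful_obs : ((Δ.teleOverE τ).N (teleShape anJ.{u}).obs).Faithful :=
  (Δ.anFFE τ _ rfl).faithful

/-- The structure functor of `𝒟_An` over `ℰ` at a vertex of `𝒟_{≤4}` other than `𝒩` is faithful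
(`id_⋎ ⋙ (𝒳 → ℰ)` on the first row when `id_⋎` is fully faithful, `𝒳 → ℰ` at `□`, `𝟭` at `ℰ`).
[cite: MochizukiAbsTopIII2015, Corollary 3.6 (i) p.80] -/
theorem teleOverE_faithful_base (hν : Δ.toNexus.FullyFaithful)
    (β : SubVertex {a : LFVertex | a.row ≤ 4}) (hβ : β.1 ≠ LFVertex.third) :
    ((Δ.teleOverE τ).N ((teleShape anJ.{u}).base β)).Faithful := by
  obtain ⟨x, hx⟩ := β
  haveI := Δ.xtoE_faithful
  haveI := hν.faithful
  cases x with
  | row1 n => exact (inferInstance : (Δ.toNexus ⋙ Δ.XtoE).Faithful)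
  | nexus => exact (inferInstance : Δ.XtoE.Faithful)
  | third => exact absurd rfl hβ
  | fourth => exact (inferInstance : (𝟭 Δ.E).Faithful)
  | fifth => exact (not_fifth_le_four hx).elim
  | sixth => exact absurd hx (by simp [LFVertex.row])

/-! ### The homotopy of a glued pair -/

/-- **The homotopy of a glued pair** (through any decomposition; independent of the choice by
`TDec.η_eq`). [cite: MochizukiAbsTopIII2015, Corollary 3.6 (iii) p.80] -/
noncomputable def teleGlueη {a b : (teleShape anJ.{u}).Vertex} {P Q : Path a b} (h : TGlueE G₁.E P Q) :
    (Δ.teleDiagram anJ (Δ.anTelMap τ)).pathFunctor P ⟶ (Δ.teleDiagram anJ (Δ.anTelMap τ)).pathFunctor Q :=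
  (Classical.choice (Δ.nonempty_tDec τ G₁ h)).η

/-- The glued homotopy is computed by ANY decomposition. [cite: MochizukiAbsTopIII2015, Corollary 3.6 (iii) p.80] -/
theorem teleGlueη_eq_η {a b : (teleShape anJ.{u}).Vertex} {P Q : Path a b} (h : TGlueE G₁.E P Q)
    (d : Δ.TDec τ G₁ P Q) : Δ.teleGlueη τ G₁ h = d.η :=
  TDec.η_eq Δ τ G₁ _ d

/-- The glued homotopy of a diagonal pair is the identity. [cite: MochizukiAbsTopIII2015, Definition 3.5 (ii) p.75] -/
theorem teleGlueη_refl {a b : (teleShape anJ.{u}).Vertex} {P : Path a b} (h : TGlueE G₁.E P P) :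
    Δ.teleGlueη τ G₁ h = 𝟙 _ :=
  TDec.η_self Δ τ G₁ _

section Over

variable (hover : ∀ ⦃x y : FVtx.{u}⦄ ⦃u v : Path x y⦄ (h : G₁.E u v),
  (Δ.teleOverE τ).IsOver (jS.mapPath u) (jS.mapPath v) (Δ.tailη τ G₁ h))
include hover

/-- Every glued homotopy lies over `ℰ`. [cite: MochizukiAbsTopIII2015, Corollary 3.6 (iii) p.81] -/
theorem teleGlueη_isOver {a b : (teleShape anJ.{u}).Vertex} {P Q : Path a b} (h : TGlueE G₁.E P Q) :
    (Δ.teleOverE τ).IsOver P Q (Δ.teleGlueη τ G₁ h) :=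
  TDec.η_isOver Δ τ G₁ hover _

/-- **Transitivity at a faithful target** (Def. 3.5 (ii): `ζ_{ϖ''} = ζ_{ϖ'} ∘ ζ_ϖ`), by uniqueness of
over-homotopies. [cite: MochizukiAbsTopIII2015, Definition 3.5 (ii) p.75] -/
theorem teleGlueη_trans_of_faithful {a b : (teleShape anJ.{u}).Vertex}
    (hb : ((Δ.teleOverE τ).N b).Faithful) {P Q R : Path a b} (h₁ : TGlueE G₁.E P Q)
    (h₂ : TGlueE G₁.E Q R) (h₃ : TGlueE G₁.E P R) :
    Δ.teleGlueη τ G₁ h₃ = Δ.teleGlueη τ G₁ h₁ ≫ Δ.teleGlueη τ G₁ h₂ :=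
  haveI := hb
  (Δ.teleGlueη_isOver τ G₁ hover h₃).eq_of_faithful
    ((Δ.teleGlueη_isOver τ G₁ hover h₁).comp (Δ.teleGlueη_isOver τ G₁ hover h₂))

/-- **Whiskering at a faithful target** (Def. 3.5 (ii), whiskering axiom), by uniqueness of
over-homotopies. [cite: MochizukiAbsTopIII2015, Definition 3.5 (ii) p.75] -/
theorem teleGlueη_whisker_of_faithful {a b c d : (teleShape anJ.{u}).Vertex}
    (hd : ((Δ.teleOverE τ).N d).Faithful) {P Q : Path a b} (h : TGlueE G₁.E P Q) (r₁ : Path c a)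
    (r₂ : Path b d) (h' : TGlueE G₁.E (r₁.comp (P.comp r₂)) (r₁.comp (Q.comp r₂))) :
    Δ.teleGlueη τ G₁ h' =
      eqToHom (by rw [pathFunctor_comp, pathFunctor_comp]) ≫
        Functor.whiskerLeft ((Δ.teleDiagram anJ (Δ.anTelMap τ)).pathFunctor r₁)
          (Functor.whiskerRight (Δ.teleGlueη τ G₁ h) ((Δ.teleDiagram anJ (Δ.anTelMap τ)).pathFunctor r₂)) ≫
        eqToHom (by rw [pathFunctor_comp, pathFunctor_comp]) :=
  haveI := hd
  (Δ.teleGlueη_isOver τ G₁ hover h').eq_of_faithful ((Δ.teleGlueη_isOver τ G₁ hover h).whisker r₁ r₂)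

end Over

/-! ### Heterogeneous forms of the split homotopies (for the containment of `𝒥`) -/

/-- `liftTail` is, heterogeneously, the whiskered lift. [cite: MochizukiAbsTopIII2015, Definition 3.5 (iv) p.76] -/
theorem liftTail_heq {a b : (teleShape anJ.{u}).Vertex} (p q : Path a (teleShape anJ.{u}).obs)
    (s : Path (teleShape anJ.{u}).obs b) :
    HEq (Δ.liftTail τ p q s)
      (Functor.whiskerRight ((Δ.teleOverE τ).lift (Δ.anFFE τ _ rfl) p q)
        ((Δ.teleDiagram anJ (Δ.anTelMap τ)).pathFunctor s)) :=
  HomotopyFamily.heq_eqToHom_comp_comp_eqToHom _ _ _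

/-- The homotopy of a split pair with EQUAL tails is, heterogeneously, the lift of the prefix pair
whiskered along the common tail. [cite: MochizukiAbsTopIII2015, Definition 3.5 (iv) p.76] -/
theorem TDec.η_tele_heq {a : (teleShape anJ.{u}).Vertex} {γ β : SubVertex {a : LFVertex | a.row ≤ 4}}
    (p q : Path a (teleShape anJ.{u}).obs) (j : anJ.{u} γ)
    (w : Path (⟨(teleShape anJ.{u}).base γ⟩ : FVtx.{u}) ⟨(teleShape anJ.{u}).base β⟩)
    (hww : w = w ∨ G₁.E w w) :
    HEq (TDec.tele p q j w w hww : Δ.TDec τ G₁ _ _).η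
      (Functor.whiskerRight ((Δ.teleOverE τ).lift (Δ.anFFE τ _ rfl) p q)
        ((Δ.teleDiagram anJ (Δ.anTelMap τ)).pathFunctor (tailPath j w))) := by
  show HEq (eqToHom _ ≫ Δ.liftTail τ p q (tailPath j w) ≫ eqToHom _ ≫
    Δ.preWhisker τ (q.cons (phiEdge j)) (Δ.θtail τ G₁ w w hww)) _
  rw [θtail_self, preWhisker_id, Category.comp_id]
  exact (HomotopyFamily.heq_eqToHom_comp_comp_eqToHom _ _ _).trans (Δ.liftTail_heq τ p q _)

/-- The glued homotopy of a pair is, heterogeneously, the homotopy of a decomposition of an EQUAL pair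
(transport of `teleGlueη_eq_η` along equalities of paths). [cite: MochizukiAbsTopIII2015, Corollary 3.6 (iii) p.80] -/
theorem teleGlueη_heq_η {a b : (teleShape anJ.{u}).Vertex} {P Q P' Q' : Path a b} (hP : P = P')
    (hQ : Q = Q') (h : TGlueE G₁.E P Q) (d : Δ.TDec τ G₁ P' Q') : HEq (Δ.teleGlueη τ G₁ h) d.η := by
  subst hP hQ
  exact heq_of_eq (Δ.teleGlueη_eq_η τ G₁ h d)

/-- **The universal homotopy of a pair through `Anab` is the glued homotopy** (heterogeneously; the
pair is an `obs`-pair — both are the lift through `Anab → ℰ` — or a split pair with equal tails —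
both are the whiskered lift of the prefix pair). [cite: MochizukiAbsTopIII2015, Corollary 3.6 (iii) p.80] -/
theorem anUnivE_η_heq_teleGlueη {a b : (teleShape anJ.{u}).Vertex}
    (p₁ q₁ : Path a (teleShape anJ.{u}).obs) (r : Path (teleShape anJ.{u}).obs b)
    (h₁ : (Δ.anUnivE τ).E (p₁.comp r) (q₁.comp r)) (h₂ : TGlueE G₁.E (p₁.comp r) (q₁.comp r)) :
    HEq ((Δ.anUnivE τ).η h₁) (Δ.teleGlueη τ G₁ h₂) := by
  -- a pair INTO `Anab`: both homotopies are the lift through `Anab → ℰ`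
  have hobs : ∀ (P Q : Path a (teleShape anJ.{u}).obs) (h₁ : (Δ.anUnivE τ).E P Q)
      (h₂ : TGlueE G₁.E P Q), HEq ((Δ.anUnivE τ).η h₁) (Δ.teleGlueη τ G₁ h₂) := fun P Q h₁ h₂ => by
    rw [Δ.anUnivE_η_eq_lift τ P Q h₁, Δ.teleGlueη_eq_η τ G₁ h₂ (TDec.obs P Q)]
    rfl
  rcases tele_cases r with ⟨r', hr⟩ | ⟨γ, r₁, j, w, hr⟩
  · have hb := eq_obs_of_fPath_obs r'
    cases hb
    exact hobs _ _ _ _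
  · subst hr
    revert h₁ h₂ w
    cases b with
    | obs => exact fun w h₁ h₂ => hobs _ _ _ _
    | base β =>
      intro w h₁ h₂
      -- a split pair with equal tails: both homotopies are the whiskered lift of the prefix pair
      have e₁ : ∀ s : Path a (teleShape anJ.{u}).obs,
          s.comp ((r₁.cons (phiEdge j)).comp (jS.mapPath w)) =
            ((s.comp r₁).cons (phiEdge j)).comp (jS.mapPath w) := fun s => by
        rw [← Path.comp_assoc, Path.comp_cons]
      have e₂ : ∀ s : Path a (teleShape anJ.{u}).obs,
          s.comp ((r₁.cons (phiEdge j)).comp (jS.mapPath w)) = (s.comp r₁).comp (tailPath j w) :=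
        fun s => (e₁ s).trans (split_eq_comp_tailPath (s.comp r₁) j w)
      have hL : HEq ((Δ.anUnivE τ).η h₁)
          (Functor.whiskerRight ((Δ.teleOverE τ).lift (Δ.anFFE τ _ rfl) (p₁.comp r₁) (q₁.comp r₁))
            ((Δ.teleDiagram anJ (Δ.anTelMap τ)).pathFunctor (tailPath j w))) := by
        rw [Δ.anUnivE_η_eq_decomp τ h₁
          ⟨(teleShape anJ.{u}).obs, rfl, p₁.comp r₁, q₁.comp r₁, tailPath j w, e₂ p₁, e₂ q₁⟩]
        exact HomotopyFamily.heq_eqToHom_comp_comp_eqToHom _ _ _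
      exact hL.trans ((Δ.teleGlueη_heq_η τ G₁ (e₁ p₁) (e₁ q₁) h₂
        (TDec.tele (p₁.comp r₁) (q₁.comp r₁) j w w (Or.inl rfl))).trans
          (TDec.η_tele_heq Δ τ G₁ _ _ j w _)).symm

/-! ### The embedding `𝒟_{≤3} ↪ 𝒟_An` factors through the telecore-free graph -/

/-- `𝒟_{≤3} ↪ Γ⃗_𝒮` (the telecore-free graph of `𝒟_An`): the vertex map of `embLogTele`, wrapped.
[cite: MochizukiAbsTopIII2015, Corollary 3.6 (iii) p.80] -/
def logToF : logObsShape.{u}.Vertex ⥤q FVtx.{u} where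
  obj a := ⟨(embLogTele anJ.{u}).obj a⟩
  map {a b} e := match a, b, e with
    | ExtVertex.base _, ExtVertex.base _, e => e
    | ExtVertex.base ⟨.nexus, _⟩, ExtVertex.obs, i => i
    | ExtVertex.base ⟨.row1 _, _⟩, ExtVertex.obs, i => PEmpty.elim i
    | ExtVertex.base ⟨.third, _⟩, ExtVertex.obs, i => PEmpty.elim i
    | ExtVertex.base ⟨.fourth, _⟩, ExtVertex.obs, i => PEmpty.elim i
    | ExtVertex.base ⟨.fifth, _⟩, ExtVertex.obs, i => PEmpty.elim i
    | ExtVertex.base ⟨.sixth, _⟩, ExtVertex.obs, i => PEmpty.elim i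
    | ExtVertex.obs, ExtVertex.base _, j => PEmpty.elim j
    | ExtVertex.obs, ExtVertex.obs, e => PEmpty.elim e

/-- `embLogTele` on edges is `logToF` followed by `jS`. [cite: MochizukiAbsTopIII2015, Corollary 3.6 (iii) p.80] -/
theorem embLogTele_map {a b : logObsShape.{u}.Vertex} (e : a ⟶ b) :
    (embLogTele anJ.{u}).map e = jS.map (logToF.map e) := by
  cases a with
  | obs =>
    cases b with
    | base _ => exact PEmpty.elim e
    | obs => exact PEmpty.elim e
  | base α =>
    cases b with
    | base _ => rfl
    | obs =>
      obtain ⟨x, hx⟩ := α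
      cases x with
      | row1 _ => exact PEmpty.elim e
      | nexus => rfl
      | third => exact PEmpty.elim e
      | fourth => exact PEmpty.elim e
      | fifth => exact PEmpty.elim e
      | sixth => exact PEmpty.elim e

/-- `embLogTele` on paths is `logToF` followed by `jS`. [cite: MochizukiAbsTopIII2015, Corollary 3.6 (iii) p.80] -/
theorem embLogTele_mapPath {a b : logObsShape.{u}.Vertex} (p : Path a b) :
    (embLogTele anJ.{u}).mapPath p = jS.mapPath (logToF.mapPath p) := by
  induction p with
  | nil => rfl
  | cons p e ih => rw [Prefunctor.mapPath_cons, ih, embLogTele_map]; rfl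

/-! ### The family of homotopies (modulo the two tail identities at `𝒩`) -/

section Family

variable (hν : Δ.toNexus.FullyFaithful)
variable (hover : ∀ ⦃x y : FVtx.{u}⦄ ⦃u v : Path x y⦄ (h : G₁.E u v),
  (Δ.teleOverE τ).IsOver (jS.mapPath u) (jS.mapPath v) (Δ.tailη τ G₁ h))
/- the transitivity identity for pairs into `𝒩` -/
variable (htrans : ∀ ⦃a : (teleShape anJ.{u}).Vertex⦄ (h₃ : LFVertex.third ∈ {a : LFVertex | a.row ≤ 4})
  ⦃P Q R : Path a ((teleShape anJ.{u}).base ⟨LFVertex.third, h₃⟩)⦄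
  (h₁ : TGlueE G₁.E P Q) (h₂ : TGlueE G₁.E Q R),
  Δ.teleGlueη τ G₁ ((isSaturated_tGlueE G₁.isSaturated).trans h₁ h₂) = Δ.teleGlueη τ G₁ h₁ ≫ Δ.teleGlueη τ G₁ h₂)
/- the whiskering identity for pairs into `𝒩` -/
variable (hwhisk : ∀ ⦃c a b : (teleShape anJ.{u}).Vertex⦄ (h₃ : LFVertex.third ∈ {a : LFVertex | a.row ≤ 4})
  ⦃P Q : Path a b⦄ (h : TGlueE G₁.E P Q) (r₁ : Path c a)
  (r₂ : Path b ((teleShape anJ.{u}).base ⟨LFVertex.third, h₃⟩)),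
  Δ.teleGlueη τ G₁ ((isSaturated_tGlueE G₁.isSaturated).precomp
      ((isSaturated_tGlueE G₁.isSaturated).postcomp h r₂) r₁) =
    eqToHom (by rw [pathFunctor_comp, pathFunctor_comp]) ≫
      Functor.whiskerLeft ((Δ.teleDiagram anJ (Δ.anTelMap τ)).pathFunctor r₁)
        (Functor.whiskerRight (Δ.teleGlueη τ G₁ h) ((Δ.teleDiagram anJ (Δ.anTelMap τ)).pathFunctor r₂)) ≫
      eqToHom (by rw [pathFunctor_comp, pathFunctor_comp]))

/-- **The glued family of homotopies on `𝒟_An`**: boundary set `TGlueE` (the core/telecore pairs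
through `Anab`, the `G₁`-pairs of telecore-free paths, and the split pairs), homotopies `teleGlueη`.  The
axioms hold by uniqueness of over-`ℰ` homotopies at every faithful target and by the two tail
identities at `𝒩` (hypotheses `htrans`, `hwhisk`). [cite: MochizukiAbsTopIII2015, Corollary 3.6 (iii) p.80] -/
noncomputable def logTeleFamily : (Δ.teleDiagram anJ (Δ.anTelMap τ)).HomotopyFamily where
  E := TGlueE G₁.E
  isSaturated := isSaturated_tGlueE G₁.isSaturated
  η := fun _ _ _ _ h => Δ.teleGlueη τ G₁ h
  η_refl := fun _ _ _ h => Δ.teleGlueη_refl τ G₁ h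
  η_trans := by
    intro a b P Q R h₁ h₂
    cases b with
    | obs => exact Δ.teleGlueη_trans_of_faithful τ G₁ hover (Δ.teleOverE_faithful_obs τ) h₁ h₂ _
    | base β =>
      by_cases hβ : β.1 = LFVertex.third
      · obtain ⟨x, hx⟩ := β
        cases hβ
        exact htrans hx h₁ h₂
      · exact Δ.teleGlueη_trans_of_faithful τ G₁ hover (Δ.teleOverE_faithful_base τ hν β hβ) h₁ h₂ _
  η_whisker := by
    intro a b c d P Q h r₁ r₂
    cases d with
    | obs => exact Δ.teleGlueη_whisker_of_faithful τ G₁ hover (Δ.teleOverE_faithful_obs τ) h r₁ r₂ _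
    | base β =>
      by_cases hβ : β.1 = LFVertex.third
      · obtain ⟨x, hx⟩ := β
        cases hβ
        exact hwhisk hx h r₁ r₂
      · exact Δ.teleGlueη_whisker_of_faithful τ G₁ hover (Δ.teleOverE_faithful_base τ hν β hβ) h r₁ r₂ _

include hν hover htrans hwhisk in
/-- The boundary set of the glued family. [cite: MochizukiAbsTopIII2015, Corollary 3.6 (iii) p.80] -/
theorem logTeleFamily_E {a b : (teleShape anJ.{u}).Vertex} (P Q : Path a b) :
    (Δ.logTeleFamily τ G₁ hν hover htrans hwhisk).E P Q ↔ TGlueE G₁.E P Q := Iff.rfl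

include hν hover htrans hwhisk in
/-- The homotopies of the glued family. [cite: MochizukiAbsTopIII2015, Corollary 3.6 (iii) p.80] -/
theorem logTeleFamily_η {a b : (teleShape anJ.{u}).Vertex} {P Q : Path a b}
    (h : TGlueE G₁.E P Q) :
    (Δ.logTeleFamily τ G₁ hν hover htrans hwhisk).η h = Δ.teleGlueη τ G₁ h := rfl

/-! ### The telecore family `𝒥` of `𝔗_An` (over `ℰ`) is contained in the glued family -/

include hν hover htrans hwhisk in
/-- The telecore family of `anTelecoreE` is contained (Def. 3.5 (ii), along the identity) in the
glued family: a pair `([γ₃]∘[γ₁], [γ₃]∘[γ₂])` through `Anab` is an `obs`- or a `tele`-pair, and both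
homotopies are the lift of the prefix pair whiskered along `[γ₃]`.
[cite: MochizukiAbsTopIII2015, Corollary 3.6 (iii) p.80] -/
theorem jfam_compatibleAlong_logTeleFamily :
    (Δ.anTelecoreE τ).Jfam.CompatibleAlong (𝟭q _) (Δ.logTeleFamily τ G₁ hν hover htrans hwhisk) := by
  intro a b p q h
  rw [Prefunctor.mapPath_id, Prefunctor.mapPath_id]
  obtain ⟨p₁, q₁, r, rfl, rfl⟩ := ((Δ.anTelecoreE τ).boundary_iff p q).mp h
  refine ⟨tGlueE_postcomp_obs p₁ q₁ r, ?_⟩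
  rw [logTeleFamily_η]
  exact Δ.anUnivE_η_heq_teleGlueη τ G₁ p₁ q₁ r h (tGlueE_postcomp_obs p₁ q₁ r)

/-! ### The `𝔖_log` family is contained in the glued family -/

include hν hover htrans hwhisk in
/-- A family `H` on `𝒟_{≤3}` contained in `G₁` along `logToF` is contained in the glued family
along `embLogTele = jS ∘ logToF` (its pairs are `free` pairs; the homotopies agree by `tailη_heq`).
[cite: MochizukiAbsTopIII2015, Corollary 3.6 (iii) p.80] -/
theorem compatibleAlong_embLogTele_logTeleFamily (H : Δ.sub3.HomotopyFamily)
    (hlog : H.CompatibleAlong logToF G₁) :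
    H.CompatibleAlong (embLogTele anJ.{u}) (Δ.logTeleFamily τ G₁ hν hover htrans hwhisk) := by
  intro a b p q h
  obtain ⟨h', hη⟩ := hlog p q h
  rw [embLogTele_mapPath, embLogTele_mapPath]
  have hd : ∀ (a b : logObsShape.{u}.Vertex) (u v : Path (logToF.obj a) (logToF.obj b))
      (huv : G₁.E u v), ∃ hf : TGlueE G₁.E (jS.mapPath u) (jS.mapPath v),
        HEq (G₁.η huv) ((Δ.logTeleFamily τ G₁ hν hover htrans hwhisk).η hf) := by
    intro a b u v huv
    cases a <;> cases b <;>
      exact ⟨TGlueE.free huv, (Δ.tailη_heq τ G₁ huv).symm.trans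
        (heq_of_eq (Δ.teleGlueη_eq_η τ G₁ (TGlueE.free huv) (TDec.free _ _ huv)).symm)⟩
  obtain ⟨hf, hfη⟩ := hd a b _ _ h'
  exact ⟨hf, hη.trans hfη⟩

/-! ### Cor. 3.6 (iii), second clause, telecore half — from a family on the telecore-free graph -/

include hν hover htrans hwhisk in
/-- **[AbsTopIII] Cor. 3.6 (iii), second clause, telecore half** — `LogObsCompatTelecoreStmt τ` — from
a family `G₁` of homotopies on the telecore-free part `Γ⃗_𝒮` of `𝒟_An` whose homotopies lie over `ℰ`
and which contains the `𝔖_log` family `H` (along `logToF`), modulo the two tail identities at `𝒩`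
(`htrans`, `hwhisk`): the telecore `𝔗_An` over `ℰ` (`anTelecoreE τ`, of the printed shape:
`anTelecoreE_isTelecoreAn`) and the glued family `logTeleFamily` on `𝒟_An`, which contains the
telecore family `𝒥` and `H`. [cite: MochizukiAbsTopIII2015, Corollary 3.6 (iii) p.80] -/
theorem logObsCompatTelecoreStmt_of_family (H : Δ.sub3.HomotopyFamily)
    (hH : Δ.IsLogObservableFamily H) (hlog : H.CompatibleAlong logToF G₁) :
    Δ.LogObsCompatTelecoreStmt τ :=
  ⟨Δ.anCoreFamilyE, _, _, Δ.anTelecoreE τ, Δ.anTelecoreE_isTelecoreAn τ,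
    Δ.logTeleFamily τ G₁ hν hover htrans hwhisk,
    Δ.jfam_compatibleAlong_logTeleFamily τ G₁ hν hover htrans hwhisk, H, hH,
    Δ.compatibleAlong_embLogTele_logTeleFamily τ G₁ hν hover htrans hwhisk H hlog⟩

end Family

end LogFrobeniusData

end Literature.AnabelianGeometry.AbsoluteAnabelian
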